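/-
Copyright: pub-hodgecm2 formalisation cell (harness21, 2026). New file (not vendored).
-/
import Summits.HodgeConjecture.HodgeCM.Model.Binders.JLiuCornerOfReflex
import Mathlib.NumberTheory.NumberField.CMField
import HarnessLib

/-!
# Δ2 bridge, orientation seam: admissibility read through `ῑ₁ = conj ∘ ι₁` is admissibility for the conjugate type

The (J3)/§4.3 admissibility predicate of a CM record `C : LiuCMSide` for a CM type `Φ` of the CM field `L`, read in `ℂ`
through a presentation embedding `ι : L → ℂ`, is `C.IsReflexOfType ι Φ := C.IsReflexOf ι (autSet ι Φ)` (the record's pair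
`(K', Φ')` is the reflex pair of `(L, Φ)`, [Liu2021] Def. 4.3 via [Shimura1998] §8.3 Prop. 28).  This file settles, in the
kernel, what happens when the presentation embedding is replaced by its complex conjugate `ῑ = conj ∘ ι`
(the Δ2-bridge «ι₁ ∕ ῑ₁ seam», DECISION #13 §4, question Q1):

* `autSet_conj` — `autSet ῑ Φ = autSet ι Φ̄` (`Φ̄ = CMTypeOps.bar Φ`, the conjugate = complementary type; [Liu2021] Rem. 4.4:
  `Φ_{μ^c} = c ∘ Φ_μ`);
* `isReflexOf_conj_iff` — for EVERY `L`-type `T ⊆ Aut_ℚ(L)`: `C.IsReflexOf ῑ T ↔ C.IsReflexOf ι T`.  Reason: the complex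
  conjugation `c` of the CM field `L` is central in `Aut_ℚ(L)` (`algEquiv_complexConj_comm`), hence preserves every reflex field
  `E = reflexFieldOf T` (`complexConj_mem_reflexFieldOf`); re-parametrising the field identification `ε : K' ≃ E` by `c|_E`
  absorbs the conjugation in BOTH clauses of `IsReflexOf` (`conj (ι (g (c x))) = ι (g x)`, `conj_apply_algEquiv_complexConj`);
* `isReflexOfType_conj_iff`, `isReflexOfTypeG_conj_iff` — **`C.IsReflexOfType ῑ Φ ↔ C.IsReflexOfType ι Φ̄`** (and the
  Galois-guarded form): admissibility through `ῑ₁` for `Φ_μ` IS admissibility through `ι₁` for `Φ̄_μ = Φ_{μ^c}`; in particular it is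
  NOT admissibility through `ι₁` for `Φ_μ` itself (the two types are complementary).

Consequence for the Δ2 packet (prose, nothing asserted): feeding the (d) block `HcmPiecesAtPin` the presentation embedding
`ιg := ῑ₁` turns its S1 output `d.IsReflexOfTypeG ῑ₁ Φ_{μ_i}` into `d.IsReflexOfTypeG ι₁ Φ̄_{μ_i}`, while the dictionary pin asks
`d.IsReflexOfTypeG ι₁ (typeOfLine (line i))` with `typeOfLine (line i) = Φ_{μ_i}` (`cmType_eq_lineType_of_deltaPos`): at `ῑ₁` the
S1 column must therefore be run for `μ^c` (or the dictionary keyed at `ῑ₁`), exactly [Liu2021] Rem. 4.4 / Prop. 4.6 (2).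

KIND: kernel; theorems only (no `def`, no named-fact hypothesis, no `sorry`); expected `#print axioms` ⊆
{propext, Classical.choice, Quot.sound}.  HC_CM is NOT proved here or by this.

References: Y. Liu, *Fourier–Jacobi cycles and arithmetic relative trace formula*, Camb. J. Math. 9 (2021), Def. 4.3, Rem. 4.4;
G. Shimura, *Abelian Varieties with Complex Multiplication and Modular Functions* (1998), §8.3 Prop. 28.
-/

set_option autoImplicit false

noncomputable section

open scoped Pointwise ComplexConjugate
open NumberField
open Literature.AlgebraicGeometry.Motives (CMType)
open Literature.NumberTheory.ComplexMultiplication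
open HodgeCM.Model (LiuCMSide)
open HodgeCM.Model.LiuCMSide (autImage reflexFieldOf reflexTypeC autSet)

namespace Summit.HodgeConjecture.CorCM.D2Bridge

variable {L : HodgeCM.CMField}

/-! ### §1 The complex conjugation of the CM field `L` is central in `Aut_ℚ(L)` and preserves every reflex field -/

/-- **Centrality of complex conjugation**: every `ℚ`-automorphism `σ` of the CM field `L` commutes with its complex conjugation
`c = IsCMField.complexConj L` (read through any complex embedding `φ`: both `φ ∘ σ ∘ c` and `φ ∘ c ∘ σ` are `conj ∘ φ ∘ σ`).
[folklore] -/
theorem algEquiv_complexConj_comm (σ : (L : Type) ≃ₐ[ℚ] L) (x : L) :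
    σ (IsCMField.complexConj L x) = IsCMField.complexConj L (σ x) := by
  obtain ⟨φ⟩ := (inferInstance : Nonempty ((L : Type) →+* ℂ))
  apply φ.injective
  have h1 : φ (σ (IsCMField.complexConj L x)) = conj (φ (σ x)) :=
    IsCMField.complexEmbedding_complexConj L (φ.comp (σ : (L : Type) →+* L)) x
  rw [h1, IsCMField.complexEmbedding_complexConj]

/-- Hence `c` preserves the reflex field `reflexFieldOf T` (the fixed field of the stabiliser `H*` of `↑ '' T`) of every
`L`-type `T ⊆ Aut_ℚ(L)`. [cite: Shimura1998, §8.3 Prop. 28] -/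
theorem complexConj_mem_reflexFieldOf (T : Set ((L : Type) ≃ₐ[ℚ] L)) {x : L} (hx : x ∈ reflexFieldOf T) :
    IsCMField.complexConj L x ∈ reflexFieldOf T := by
  have hx' : x ∈ IntermediateField.fixedField
      (MulAction.stabilizer ((L : Type) ≃ₐ[ℚ] L) (autImage T)) := hx
  show IsCMField.complexConj L x ∈ IntermediateField.fixedField
      (MulAction.stabilizer ((L : Type) ≃ₐ[ℚ] L) (autImage T))
  rw [IntermediateField.mem_fixedField_iff] at hx' ⊢
  intro f hf
  rw [algEquiv_complexConj_comm, hx' f hf]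

/-- The pointwise identity behind the seam: `conj (ι (g (c x))) = ι (g x)` for every complex embedding `ι`, automorphism `g`
and `x ∈ L` (`ι ∘ g` is again a complex embedding, so it intertwines `c` with `conj`). [folklore] -/
theorem conj_apply_algEquiv_complexConj (ι : (L : Type) →+* ℂ) (g : (L : Type) ≃ₐ[ℚ] L) (x : L) :
    conj (ι (g (IsCMField.complexConj L x))) = ι (g x) := by
  rw [algEquiv_complexConj_comm, IsCMField.complexEmbedding_complexConj, starRingEnd_self_apply]

/-- `conj ∘ (conj ∘ ι) = ι`. [folklore] -/
theorem starRingEnd_comp_starRingEnd_comp (ι : (L : Type) →+* ℂ) :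
    (starRingEnd ℂ).comp ((starRingEnd ℂ).comp ι) = ι :=
  RingHom.ext fun x => starRingEnd_self_apply (ι x)

/-! ### §2 `IsReflexOf` does not see the conjugation of the presentation embedding -/

/-- **One direction of the seam lemma**: if `C` is the reflex side of `T` read through `conj ∘ ι`, it is the reflex side of
`T` read through `ι` — re-parametrise `ε : K' ≃ reflexFieldOf T` by the restriction of `c` to the (c-stable) reflex field.
[cite: Shimura1998, §8.3 Prop. 28] -/
theorem isReflexOf_of_conj (ι : (L : Type) →+* ℂ) (C : LiuCMSide) (T : Set ((L : Type) ≃ₐ[ℚ] L))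
    (h : C.IsReflexOf ((starRingEnd ℂ).comp ι) T) : C.IsReflexOf ι T := by
  obtain ⟨ε, hτ, hΦ⟩ := h
  -- the restriction of complex conjugation to the reflex field (an involutive ring automorphism)
  let cE : ↥(reflexFieldOf T) ≃+* ↥(reflexFieldOf T) :=
    { toFun := fun y => ⟨IsCMField.complexConj L y, complexConj_mem_reflexFieldOf T y.2⟩
      invFun := fun y => ⟨IsCMField.complexConj L y, complexConj_mem_reflexFieldOf T y.2⟩
      left_inv := fun y => Subtype.ext (IsCMField.complexConj_apply_apply L (y : L))
      right_inv := fun y => Subtype.ext (IsCMField.complexConj_apply_apply L (y : L))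
      map_mul' := fun y z => Subtype.ext (map_mul (IsCMField.complexConj L) (y : L) z)
      map_add' := fun y z => Subtype.ext (map_add (IsCMField.complexConj L) (y : L) z) }
  have cE_apply : ∀ y : ↥(reflexFieldOf T), ((cE y : ↥(reflexFieldOf T)) : L) = IsCMField.complexConj L y := fun _ => rfl
  have cE_cE : ∀ y : ↥(reflexFieldOf T), cE (cE y) = y :=
    fun y => Subtype.ext (IsCMField.complexConj_apply_apply L (y : L))
  refine ⟨ε.trans cE, ?_, fun ψ => ?_⟩
  · -- clause (i): `τ ∘ k = conj ∘ ι ∘ incl ∘ ε = ι ∘ incl ∘ (c|_E ∘ ε)`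
    rw [hτ]
    refine RingHom.ext fun x => ?_
    show conj (ι ((ε x : ↥(reflexFieldOf T)) : L)) = ι ((cE (ε x) : ↥(reflexFieldOf T)) : L)
    rw [cE_apply, IsCMField.complexEmbedding_complexConj]
  · -- clause (ii): the reflex type through `conj ∘ ι`, precomposed with `c|_E`, is the reflex type through `ι`
    rw [hΦ ψ]
    have hsymm : ψ.comp (ε.trans cE).symm.toRingHom = (ψ.comp ε.symm.toRingHom).comp cE.toRingHom :=
      RingHom.ext fun _ => rfl
    rw [hsymm]
    generalize ψ.comp ε.symm.toRingHom = χ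
    constructor
    · rintro ⟨g, hg, hχ⟩
      refine ⟨g, hg, RingHom.ext fun x => ?_⟩
      show χ (cE x) = ι (g (x : L))
      rw [RingHom.congr_fun hχ (cE x)]
      show conj (ι (g ((cE x : ↥(reflexFieldOf T)) : L))) = ι (g (x : L))
      rw [cE_apply, conj_apply_algEquiv_complexConj]
    · rintro ⟨g, hg, hχ⟩
      refine ⟨g, hg, RingHom.ext fun x => ?_⟩
      show χ x = conj (ι (g (x : L)))
      have h2 : χ x = (χ.comp cE.toRingHom) (cE x) := by
        show χ x = χ (cE (cE x))
        rw [cE_cE]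
      rw [h2, hχ]
      show ι (g ((cE x : ↥(reflexFieldOf T)) : L)) = conj (ι (g (x : L)))
      rw [cE_apply, ← conj_apply_algEquiv_complexConj ι g (x : L), starRingEnd_self_apply]

/-- **The seam lemma for `IsReflexOf`**: for every `L`-type `T`, being its reflex side read through `conj ∘ ι` is the same as
read through `ι`. [cite: Shimura1998, §8.3 Prop. 28] -/
theorem isReflexOf_conj_iff (ι : (L : Type) →+* ℂ) (C : LiuCMSide) (T : Set ((L : Type) ≃ₐ[ℚ] L)) :
    C.IsReflexOf ((starRingEnd ℂ).comp ι) T ↔ C.IsReflexOf ι T := by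
  refine ⟨isReflexOf_of_conj ι C T, fun h => isReflexOf_of_conj ((starRingEnd ℂ).comp ι) C T ?_⟩
  rwa [starRingEnd_comp_starRingEnd_comp]

/-! ### §3 `autSet` and `IsReflexOfType`: the conjugate embedding selects the conjugate type -/

/-- `autSet (conj ∘ ι) Φ = autSet ι Φ̄`: `conj ∘ ι ∘ g ∈ Φ ↔ ι ∘ g ∈ Φ̄` (the CM-type axiom).
[cite: Liu2021, Remark 4.4] -/
theorem autSet_conj (ι : (L : Type) →+* ℂ) (Φ : CMType L) :
    autSet ((starRingEnd ℂ).comp ι) Φ = autSet ι (HodgeCM.CMTypeOps.bar Φ) := by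
  ext g
  show ((starRingEnd ℂ).comp ι).comp g.toRingEquiv.toRingHom ∈ Φ.1 ↔
    ι.comp g.toRingEquiv.toRingHom ∈ (HodgeCM.CMTypeOps.bar Φ).1
  have hc : ((starRingEnd ℂ).comp ι).comp g.toRingEquiv.toRingHom =
      ComplexEmbedding.conjugate (ι.comp g.toRingEquiv.toRingHom) :=
    RingHom.ext fun _ => rfl
  rw [hc, HodgeCM.CMTypeOps.mem_bar_iff, HodgeCM.CMTypeOps.conjugate_mem_iff_notMem]

/-- **The seam lemma for the admissibility predicate** (Δ2 DECISION #13 §4, Q1): `C.IsReflexOfType (conj ∘ ι) Φ ↔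
C.IsReflexOfType ι Φ̄` — admissibility through the conjugate presentation embedding for `Φ_μ` is admissibility through `ι`
for the conjugate type `Φ̄_μ = Φ_{μ^c}`. [cite: Liu2021, Definition 4.3, Remark 4.4] -/
theorem isReflexOfType_conj_iff (ι : (L : Type) →+* ℂ) (C : LiuCMSide) (Φ : CMType L) :
    C.IsReflexOfType ((starRingEnd ℂ).comp ι) Φ ↔ C.IsReflexOfType ι (HodgeCM.CMTypeOps.bar Φ) := by
  unfold LiuCMSide.IsReflexOfType
  rw [autSet_conj]
  exact isReflexOf_conj_iff ι C _

/-- The same for the Galois-guarded predicate `IsReflexOfTypeG` (the dictionary's `adm`). [cite: Liu2021, Definition 4.3, Remark 4.4] -/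
theorem isReflexOfTypeG_conj_iff (ι : (L : Type) →+* ℂ) (C : LiuCMSide) (Φ : CMType L) :
    C.IsReflexOfTypeG ((starRingEnd ℂ).comp ι) Φ ↔ C.IsReflexOfTypeG ι (HodgeCM.CMTypeOps.bar Φ) := by
  unfold LiuCMSide.IsReflexOfTypeG
  exact imp_congr_right fun _ => isReflexOfType_conj_iff ι C Φ

/-- `Φ̄̄ = Φ`. [folklore] -/
theorem _root_.HodgeCM.CMTypeOps.bar_bar {K : Type} [Field K] (Φ : CMType K) :
    HodgeCM.CMTypeOps.bar (HodgeCM.CMTypeOps.bar Φ) = Φ :=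
  Subtype.ext (compl_compl Φ.1)

/-- The seam lemma read the other way: admissibility through `ι` for `Φ` is admissibility through `conj ∘ ι` for `Φ̄`.
[cite: Liu2021, Definition 4.3, Remark 4.4] -/
theorem isReflexOfTypeG_iff_conj_bar (ι : (L : Type) →+* ℂ) (C : LiuCMSide) (Φ : CMType L) :
    C.IsReflexOfTypeG ι Φ ↔ C.IsReflexOfTypeG ((starRingEnd ℂ).comp ι) (HodgeCM.CMTypeOps.bar Φ) := by
  rw [isReflexOfTypeG_conj_iff, HodgeCM.CMTypeOps.bar_bar]

end Summit.HodgeConjecture.CorCM.D2Bridge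

end
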